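import Summits.RiemannHypothesis.RiemannHypothesis.Theorems.Splittings.BombieriTruncExactness

/-!
# Splittings — x-wuc (xiv-c2, optional): Gram positivity from the Simple Zeros Conjecture and the SZC rows X-5s

Cell rh-split, seat rh-split-x-wuc g5 (brief sha16 f79c5f09d8bcb036), card `run/shared/lean/pub/rh-split/cards/SPLIT-x-wuc.md` §11
(referee rh-split-ref g3 2026-08-27T06:23:10Z: REPLAY PASS of the scratch `HOME/rh-split-x-wuc/SplitXWucG5.lean`; lead RULING #35:
cut (xiv)).  Carved VERBATIM from that scratch (file of record sha16 66b013c38c58c722); sections as numbered there.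
* §7 `SimpleZeros`, `gamma_injective_of_simpleZeros`, `gramPosDef_of_injective`, `gramPosDef_of_simpleZeros`, `rh_iff_eventualStrip_and_boundedAway_of_simpleZeros`,
  `repelled_of_boundedAway_of_simpleZeros`; §8 row `rh_iff_eventualStrip_and_pencil_of_simpleZeros`; §13 row `rh_iff_eventualStrip_and_boundedAway_prov
  (h : Corollary11Prov) (hS : SimpleZeros)`.  LABEL: conditional bookkeeping (SZC + Corollary11Prov in hypothesis position).
HONEST LABEL: «SPLITTING SEARCH over kernel-typed RH-EQUIVALENCES; a splitting A ∧ B ⟹ RH is CONDITIONAL bookkeeping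
unless A and B are both proved; nothing here bears on the truth of RH.»
-/

set_option linter.dupNamespace false

noncomputable section

open scoped Classical ComplexConjugate
open Set Filter Topology Complex MeasureTheory

namespace Summit.RiemannHypothesis.RiemannHypothesis.Theorems.Splittings.BombieriTruncSimpleZeros

open Literature.NumberTheory.LFunctions Literature.NumberTheory.LFunctions.Bombieri2000
open Summit.RiemannHypothesis.RiemannHypothesis.Theses.RuelleBand
open Summit.RiemannHypothesis.RiemannHypothesis.Theorems.Splittings.BombieriTruncEigen
open Summit.RiemannHypothesis.RiemannHypothesis.Theorems.Splittings.BombieriFozNoDep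
open Summit.RiemannHypothesis.RiemannHypothesis.Theorems.Splittings.BombieriTruncGram
open Summit.RiemannHypothesis.RiemannHypothesis.Theorems.Splittings.BombieriTruncPairing
open Summit.RiemannHypothesis.RiemannHypothesis.Theorems.Splittings.BombieriTruncScreening
open Summit.RiemannHypothesis.RiemannHypothesis.Theorems.Splittings.BombieriTruncBandGap
open Summit.RiemannHypothesis.RiemannHypothesis.Theorems.Splittings.BombieriTruncMultiplicity
open Summit.RiemannHypothesis.RiemannHypothesis.Theorems.Splittings.BombieriTruncEventualStrip
open Summit.RiemannHypothesis.RiemannHypothesis.Theorems.Splittings.BombieriTruncExactness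

variable {E : Set ℝ} {N : ℕ}

/-! ## §7 Gram positivity from simplicity (Helgason III §3 Lemma 3.15 + identity theorem)

`GramPosDef E N` fails as soon as `Γ_N` carries a multiple zero (two equal columns). Conversely, if the `γ_j`
(`j ∈ Γ_N`) are distinct — in particular under the Simple Zeros Conjecture — the Gram form on any window
`[−a, a]`, `a > 0`, is positive definite: `∫_{−a}^{a} |Σ x_j e^{−iγ_j u}|² du = 0` forces the exponential polynomial
to vanish on `(−a, a)`, hence on `ℝ` (identity theorem), hence `x = 0` (tree: `eq_zero_of_sum_eval_mul_exp_eq_zero'`). -/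

/-- **Simple Zeros Conjecture** (all non-trivial zeros of `ζ` are simple). [MV §10.1 p. 266: «All known zeros of the
zeta function are simple, and it is plausible to conjecture that they all are.»] -/
@[conjecture] def SimpleZeros : Prop := ∀ ρ ∈ ZetaZeros.riemannZetaNontrivialZeros, riemannZetaZeroOrder ρ = 1

/-- Under `SimpleZeros` the ordinate map `i ↦ γ_i` on zero indices is injective. -/
theorem gamma_injective_of_simpleZeros (h : SimpleZeros) : Function.Injective ZeroIdx.gamma := by
  rintro ⟨ρ, k⟩ ⟨ρ', k'⟩ hij
  have hv : (ρ : ℂ) = (ρ' : ℂ) := by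
    have e1 := ZeroIdx.val_eq_gamma ⟨ρ, k⟩
    have e2 := ZeroIdx.val_eq_gamma ⟨ρ', k'⟩
    rw [hij, ← e2] at e1
    exact e1
  have hρ : ρ = ρ' := Subtype.ext hv
  subst hρ
  have h1 : (riemannZetaZeroOrder (ρ : ℂ)).toNat = 1 := by rw [h ρ ρ.2]; rfl
  have hk : k = k' := Fin.ext (by have := k.2; have := k'.2; omega)
  rw [hk]


/-- Distinct `γ`'s on `Γ_N` ⟹ the Gram form on `[−a, a]` (`a > 0`) is positive definite. -/
theorem gramPosDef_of_injective {a : ℝ} (ha : 0 < a)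
    (hinj : Function.Injective fun j : truncIdx N ↦ (j : ZeroIdx).gamma) : GramPosDef (Icc (-a) a) N := by
  intro x hx
  by_contra hle
  push Not at hle
  -- Step A: the exponential polynomial vanishes on `(−a, a)`
  set g : ℝ → ℝ := fun u ↦ ‖F N x u‖ ^ 2 with hg
  have hgc : Continuous g := by rw [hg]; exact ((continuous_F x).norm).pow 2
  have hgi : IntegrableOn g (Icc (-a) a) := hgc.integrableOn_Icc
  have hzero : ∀ u ∈ Ioo (-a) a, F N x u = 0 := by
    by_contra hne
    push Not at hne
    obtain ⟨u₀, hu₀, hF0⟩ := hne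
    have hopen : IsOpen (Function.support g ∩ Ioo (-a) a) :=
      (isOpen_compl_singleton.preimage hgc).inter isOpen_Ioo
    have hmem : u₀ ∈ Function.support g ∩ Ioo (-a) a :=
      ⟨by rw [Function.mem_support, hg]; positivity, hu₀⟩
    have hpos : 0 < volume (Function.support g ∩ Ioo (-a) a) := hopen.measure_pos volume ⟨u₀, hmem⟩
    have hpos' : 0 < (volume.restrict (Icc (-a) a)) (Function.support g) := by
      rw [Measure.restrict_apply' measurableSet_Icc]
      exact hpos.trans_le (measure_mono (Set.inter_subset_inter_right _ Ioo_subset_Icc_self))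
    have hint : 0 < ∫ u in Icc (-a) a, g u :=
      (integral_pos_iff_support_of_nonneg_ae (Eventually.of_forall fun u ↦ by rw [hg]; positivity) hgi).2 hpos'
    exact absurd hle (not_le.2 hint)
  -- Step B: hence on all of `ℝ` (identity theorem for the entire function `w ↦ Σ x_j e^{−iγ_j w}`)
  set Fc : ℂ → ℂ := fun w ↦ ∑ j : truncIdx N, x j * cexp (-(I * (j : ZeroIdx).gamma * w)) with hFc
  have hdiff : Differentiable ℂ Fc := by rw [hFc]; fun_prop
  have han : AnalyticOnNhd ℂ Fc univ := Complex.analyticOnNhd_univ_iff_differentiable.2 hdiff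
  have hfreq : ∃ᶠ z in 𝓝[≠] (0 : ℂ), Fc z = 0 := by
    rw [Filter.Frequently, eventually_nhdsWithin_iff, Metric.eventually_nhds_iff]
    rintro ⟨ε, hε, hall⟩
    set u : ℝ := min (ε / 2) (a / 2) with hu
    have hu0 : 0 < u := lt_min (by linarith) (by linarith)
    have huε : u < ε := (min_le_left _ _).trans_lt (by linarith)
    have hua : u < a := (min_le_right _ _).trans_lt (by linarith)
    have h1 : dist (u : ℂ) 0 < ε := by
      rw [dist_zero_right, Complex.norm_real, Real.norm_of_nonneg hu0.le]; exact huε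
    have h2 : (u : ℂ) ∈ ({0}ᶜ : Set ℂ) := by
      rw [Set.mem_compl_singleton_iff, Ne, Complex.ofReal_eq_zero]; exact hu0.ne'
    exact hall h1 h2 (hzero u ⟨by linarith, hua⟩)
  have hall : ∀ t : ℝ, Fc t = 0 := fun t ↦
    han.eqOn_zero_of_preconnected_of_frequently_eq_zero isPreconnected_univ (Set.mem_univ 0) hfreq
      (Set.mem_univ _)
  -- Step C: Helgason's lemma with constant polynomials
  have hc : Function.Injective fun j : truncIdx N ↦ -I * (j : ZeroIdx).gamma := by
    intro i j hij
    apply hinj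
    have := mul_left_cancel₀ (neg_ne_zero.2 Complex.I_ne_zero) hij
    exact this
  have hsum : ∀ t : ℝ, ∑ j : truncIdx N, (Polynomial.C (x j)).eval (t : ℂ) *
      Complex.exp (-I * (j : ZeroIdx).gamma * t) = 0 := by
    intro t
    have := hall t
    simp only [hFc] at this
    simpa only [Polynomial.eval_C, neg_mul] using this
  apply hx
  funext j
  have hp := Literature.Analysis.ODE.ExpPolynomialsLinearIndependent.eq_zero_of_sum_eval_mul_exp_eq_zero' hc hsum j
  simpa using hp

/-- Under the Simple Zeros Conjecture every truncated Gram form on `[−a, a]`, `a > 0`, is positive definite. -/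
theorem gramPosDef_of_simpleZeros (h : SimpleZeros) {a : ℝ} (ha : 0 < a) (N : ℕ) : GramPosDef (Icc (-a) a) N :=
  gramPosDef_of_injective ha fun _ _ hij ↦ Subtype.ext (gamma_injective_of_simpleZeros h hij)

/-- **Row X-5s, final kernel form.** Modulo row C5 (`hC5`, print fact [Bo, Cor. 11] inside) and `RH → B′` (g4),
the Simple Zeros Conjecture gives `RH ⟺ ES ∧ B′([−1,1])`. [new-combination] -/
theorem rh_iff_eventualStrip_and_boundedAway_of_simpleZeros
    (hC5 : CofiniteCriticalLine → TruncNegEigenvalueBoundedAway (Icc (-1) 1) → _root_.RiemannHypothesis)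
    (hBrh : _root_.RiemannHypothesis → TruncNegEigenvalueBoundedAway (Icc (-1) 1)) (hS : SimpleZeros) :
    _root_.RiemannHypothesis ↔ EventualStrip ∧ TruncNegEigenvalueBoundedAway (Icc (-1) 1) :=
  rh_iff_eventualStrip_and_boundedAway hC5 hBrh (gramPosDef_of_simpleZeros hS one_pos)

/-- and the band gap under SZC alone: `B′(E)`, `E ⊆ [−1,1]` a window... stated for `E = [−1, 1]`. -/
theorem repelled_of_boundedAway_of_simpleZeros (hS : SimpleZeros)
    (hB : TruncNegEigenvalueBoundedAway (Icc (-1) 1)) :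
    ∃ η₀ : ℝ, 0 < η₀ ∧ ∀ i : ZeroIdx, i.OffLine → η₀ ≤ |i.val.re - 1 / 2| :=
  repelled_of_boundedAway subset_rfl (gramPosDef_of_simpleZeros hS one_pos) hB

/-- Row X-5s in pencil form under SZC: `RH ⟺ ES ∧ PENCIL([−1,1])` (modulo row C5 and `RH → B′`). [new-combination] -/
theorem rh_iff_eventualStrip_and_pencil_of_simpleZeros
    (hC5 : CofiniteCriticalLine → TruncNegEigenvalueBoundedAway (Icc (-1) 1) → _root_.RiemannHypothesis)
    (hBrh : _root_.RiemannHypothesis → TruncNegEigenvalueBoundedAway (Icc (-1) 1)) (hS : SimpleZeros) :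
    _root_.RiemannHypothesis ↔ EventualStrip ∧ PencilNonneg (Icc (-1) 1) := by
  rw [pencilNonneg_iff_boundedAway subset_rfl (gramPosDef_of_simpleZeros hS one_pos)]
  exact rh_iff_eventualStrip_and_boundedAway_of_simpleZeros hC5 hBrh hS

open Summit.RiemannHypothesis.RiemannHypothesis.Theorems.Splittings.BombieriCorollaryProvenance in
/-- Row X-5s under SZC, modulo `Corollary11Prov` only: `RH ⟺ ES ∧ B′([−1,1])`. [new-combination] -/
theorem rh_iff_eventualStrip_and_boundedAway_prov (h : Corollary11Prov) (hS : SimpleZeros) :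
    _root_.RiemannHypothesis ↔ EventualStrip ∧ TruncNegEigenvalueBoundedAway (Icc (-1) 1) :=
  rh_iff_eventualStrip_and_boundedAway_of_simpleZeros (fun hfoz hB ↦ rh_of_foz_of_boundedAway_one h hfoz hB)
    (fun hRH ↦ truncNegEigenvalueBoundedAway_Icc_of_rh hRH 1) hS

end Summit.RiemannHypothesis.RiemannHypothesis.Theorems.Splittings.BombieriTruncSimpleZeros
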